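import Mathlib.Algebra.DualNumber
import Mathlib.Algebra.BigOperators.Group.Finset.Basic
import Mathlib.RingTheory.Ideal.Span
import Mathlib.Algebra.Regular.Basic
import Mathlib.Tactic.LinearCombination
import Mathlib.Tactic.Ring
import HarnessLib

/-!
# Venture HSemireg — branch lifts of a normal-crossing germ over the dual numbers

Elementary algebra of first-order embedded deformations of a reduced normal-crossing hypersurface
germ `q = x₁ ⋯ x_m = 0`, over the dual numbers `R[ε]` (`ε² = 0`) of a commutative ring `R`:

* `prod_inl_add_smul_eps` — **`∏ᵢ (xᵢ + ε hᵢ) = q + ε · Σᵢ hᵢ ∏_{j ≠ i} x_j`**: a first-order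
  deformation `q + εh` of the crossing all of whose branches lift is exactly one whose `h` lies in
  the Jacobian-type ideal `(∏_{j≠i} x_j)_i`, i.e. whose class in `T¹ = R ⧸ (q, ∂q)` vanishes
  (the «g = 0 ⇒ every branch lifts» half of THEOREM CC-D (a) of the cell record);
* `dvd_iff` — for a left-regular `a`: **`(a + εk) ∣ (ab + εh)` in `R[ε]` iff `a ∣ h − kb`**;
* `span_singleton_eq_iff` — for a left-regular `a`: the principal ideals `(a + εk)` and `(a + εk')`
  of `R[ε]` coincide iff `a ∣ k' − k`: **the first-order lift `V(x₁ + εk)` of the branch `V(x₁)` is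
  determined by `k mod x₁`**;
* `branch_dvd_iff`, `branch_dvd_iff_of_regular_mod` — the combination used in CC-D (a): the branch
  lift `V(x₁ + εk)` lies inside `V(q + εh)`, `q = x₁P`, `h = h₁P + x₁h'`, iff `x₁ ∣ (h₁ − k)P`, iff
  (when `P` is a non-zero-divisor modulo `x₁`) `x₁ ∣ h₁ − k` — **the branch lift inside the deformed
  crossing is UNIQUE**.

HONEST FRAMING. Commutative algebra over `R[ε]` only; Lean index of the local algebra step of a
NEGATIVE structure theorem (THEOREM CC-D (a), `widen/W1/CLEAN-COMPONENT-THEOREM-w1tw1.md` §18) of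
the computation cell `pub-hsemireg` (seat w1-tw-1, W1). No scheme, sheaf, abelian variety or
semiregularity map appears; nothing here says that HC, HC_CM or HC_AV holds, and nothing here is a
new case of anything.
-/

open DualNumber TrivSqZeroExt

namespace Summit.Ventures.HSemireg

namespace BranchLift

universe u v

variable {R : Type u} [CommRing R]

/-- `fst` of a finite product in `R[ε]` is the product of the `fst`'s (reduction mod `ε` is a
ring map). [cite: Hartshorne2010, §2] -/
theorem fst_prod {ι : Type v} (s : Finset ι) (f : ι → R[ε]) :
    fst (∏ i ∈ s, f i) = ∏ i ∈ s, fst (f i) := by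
  classical
  induction s using Finset.induction_on with
  | empty => simp
  | insert a s ha ih => rw [Finset.prod_insert ha, Finset.prod_insert ha, fst_mul, ih]

/-- `snd` of a finite product in `R[ε]` — the Leibniz rule:
`snd (∏ᵢ fᵢ) = Σᵢ snd fᵢ · ∏_{j ≠ i} fst f_j`. [cite: Hartshorne2010, §2] -/
theorem snd_prod {ι : Type v} [DecidableEq ι] (s : Finset ι) (f : ι → R[ε]) :
    snd (∏ i ∈ s, f i) = ∑ i ∈ s, snd (f i) * ∏ j ∈ s.erase i, fst (f j) := by
  induction s using Finset.induction_on with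
  | empty => simp
  | insert a s ha ih =>
    rw [Finset.prod_insert ha, DualNumber.snd_mul, ih, fst_prod, Finset.sum_insert ha,
      Finset.erase_insert ha, add_comm, Finset.mul_sum]
    congr 1
    refine Finset.sum_congr rfl fun i hi => ?_
    have hia : i ≠ a := fun h => ha (h ▸ hi)
    rw [Finset.erase_insert_of_ne hia.symm,
      Finset.prod_insert (fun h => ha (Finset.mem_of_mem_erase h))]
    ring

/-- **All branches lift ⇒ the product is the deformed crossing.** In `R[ε]`,
`∏ᵢ (xᵢ + hᵢ ε) = (∏ᵢ xᵢ) + (Σᵢ hᵢ ∏_{j≠i} x_j) ε`: a first-order deformation `q + εh` of the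
normal-crossing germ `q = ∏ xᵢ` with `h` in the ideal `(∏_{j≠i} x_j : i)` — i.e. with vanishing
class in `T¹ = R ⧸ (q, ∂q)` — is the product of the branch lifts `xᵢ + εhᵢ`.
[cite: Hartshorne2010, §3] -/
theorem prod_inl_add_smul_eps {ι : Type v} [DecidableEq ι] (s : Finset ι) (x h : ι → R) :
    ∏ i ∈ s, (inl (x i) + h i • (ε : R[ε])) =
      inl (∏ i ∈ s, x i) + (∑ i ∈ s, h i * ∏ j ∈ s.erase i, x j) • (ε : R[ε]) := by
  apply TrivSqZeroExt.ext
  · rw [fst_prod]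
    simp
  · rw [snd_prod]
    simp

/-- **Divisibility by a branch lift.** For a left-regular `a ∈ R` and `b k h ∈ R`:
`(a + εk) ∣ (ab + εh)` in `R[ε]` iff `a ∣ h − kb` in `R`. [cite: Hartshorne2010, §2] -/
theorem dvd_iff (a b k h : R) (ha : IsLeftRegular a) :
    (inl a + k • (ε : R[ε])) ∣ (inl (a * b) + h • (ε : R[ε])) ↔ a ∣ (h - k * b) := by
  constructor
  · rintro ⟨c, hc⟩
    have h1 := congrArg fst hc
    have h2 := congrArg snd hc
    simp only [fst_add, fst_inl, fst_smul, fst_eps, smul_eq_mul, mul_zero, add_zero,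
      fst_mul] at h1
    simp only [snd_add, snd_inl, snd_smul, snd_eps, smul_eq_mul, mul_one, zero_add,
      DualNumber.snd_mul, fst_add, fst_inl, fst_smul, fst_eps, mul_zero, add_zero] at h2
    -- `h1 : a * b = a * fst c`, `h2 : h = a * snd c + k * fst c`
    have hc0 : b = fst c := ha h1
    exact ⟨snd c, by rw [h2, ← hc0]; ring⟩
  · rintro ⟨c, hc⟩
    refine ⟨inl b + c • (ε : R[ε]), ?_⟩
    apply TrivSqZeroExt.ext
    · simp
    · simp only [snd_add, snd_inl, snd_smul, snd_eps, smul_eq_mul, mul_one, zero_add,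
        DualNumber.snd_mul, fst_add, fst_inl, fst_smul, fst_eps, mul_zero, add_zero]
      linear_combination hc

/-- **The branch lift is determined modulo the branch.** For a left-regular `a ∈ R`: the
principal ideals `(a + εk)` and `(a + εk')` of `R[ε]` are equal iff `a ∣ k' − k` — the lifts
`V(x₁ + εk)` of the branch `V(x₁)` are parametrised by `k mod x₁`, i.e. by `Hom(I/I², O)`.
[cite: Hartshorne2010, §2] -/
theorem span_singleton_eq_iff (a k k' : R) (ha : IsLeftRegular a) :
    Ideal.span {inl a + k • (ε : R[ε])} = Ideal.span {inl a + k' • (ε : R[ε])} ↔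
      a ∣ (k' - k) := by
  constructor
  · intro hspan
    have hmem : inl a + k' • (ε : R[ε]) ∈ Ideal.span {inl a + k • (ε : R[ε])} :=
      hspan ▸ Ideal.mem_span_singleton_self _
    obtain ⟨c, hc⟩ := Ideal.mem_span_singleton'.mp hmem
    have h1 := congrArg fst hc
    have h2 := congrArg snd hc
    simp only [fst_mul, fst_add, fst_inl, fst_smul, fst_eps, smul_eq_mul, mul_zero,
      add_zero] at h1
    simp only [DualNumber.snd_mul, snd_add, snd_inl, snd_smul, snd_eps, smul_eq_mul, mul_one,
      zero_add, fst_add, fst_inl, fst_smul, fst_eps, mul_zero, add_zero] at h2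
    -- `h1 : fst c * a = a`, `h2 : fst c * k + snd c * a = k'`
    have hc1 : fst c = 1 := ha (show a * fst c = a * 1 by rw [mul_one, mul_comm]; exact h1)
    rw [hc1, one_mul] at h2
    exact ⟨snd c, by linear_combination -h2⟩
  · rintro ⟨c, hc⟩
    have key : inl a + k' • (ε : R[ε]) = (inl a + k • (ε : R[ε])) * (1 + c • (ε : R[ε])) := by
      apply TrivSqZeroExt.ext
      · simp
      · simp only [snd_add, snd_inl, snd_smul, snd_eps, smul_eq_mul, mul_one, zero_add,
          DualNumber.snd_mul, fst_add, fst_inl, fst_smul, fst_eps, mul_zero, add_zero,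
          fst_one, snd_one]
        linear_combination hc
    have hu : IsUnit (1 + c • (ε : R[ε])) := by
      rw [isUnit_iff_isUnit_fst]
      simp
    rw [key, Ideal.span_singleton_mul_right_unit hu]

/-- **CC-D (a), the local step.** Write the crossing as `q = x₁ · P` (`P` = the product of the other
branches) and a first-order deformation as `q + εh` with `h = h₁ P + x₁ h'`. For `x₁` left-regular:
the branch lift `V(x₁ + εk)` lies in `V(q + εh)` — i.e. `(x₁ + εk) ∣ (q + εh)` — iff
`x₁ ∣ (h₁ − k) · P`. [cite: Hartshorne2010, §3] -/
theorem branch_dvd_iff (x₁ P h₁ h' k : R) (hx : IsLeftRegular x₁) :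
    (inl x₁ + k • (ε : R[ε])) ∣ (inl (x₁ * P) + (h₁ * P + x₁ * h') • (ε : R[ε])) ↔
      x₁ ∣ (h₁ - k) * P := by
  rw [dvd_iff _ _ _ _ hx]
  constructor
  · rintro ⟨c, hc⟩
    exact ⟨c - h', by linear_combination hc⟩
  · rintro ⟨c, hc⟩
    exact ⟨c + h', by linear_combination hc⟩

/-- **Uniqueness of the branch lift inside the deformed crossing.** If moreover `P` is a
non-zero-divisor modulo `x₁` (the other branches do not contain `V(x₁)`: `x₁ ∣ rP ⇒ x₁ ∣ r`), then
`V(x₁ + εk) ⊂ V(q + εh)` iff `x₁ ∣ h₁ − k`: together with `span_singleton_eq_iff`, the lift of the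
branch `V(x₁)` inside `V(q + εh)` is UNIQUE (namely `V(x₁ + εh₁)`). [cite: Hartshorne2010, §3] -/
theorem branch_dvd_iff_of_regular_mod (x₁ P h₁ h' k : R) (hx : IsLeftRegular x₁)
    (hP : ∀ r : R, x₁ ∣ r * P → x₁ ∣ r) :
    (inl x₁ + k • (ε : R[ε])) ∣ (inl (x₁ * P) + (h₁ * P + x₁ * h') • (ε : R[ε])) ↔
      x₁ ∣ (h₁ - k) := by
  rw [branch_dvd_iff _ _ _ _ _ hx]
  exact ⟨hP _, fun ⟨c, hc⟩ => ⟨c * P, by rw [hc]; ring⟩⟩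

/-- The uniqueness packaged: under the hypotheses of `branch_dvd_iff_of_regular_mod`, any two branch
lifts `V(x₁ + εk)`, `V(x₁ + εk')` contained in the deformed crossing `V(q + εh)` are the SAME closed
subscheme of `Spec R[ε]` (equal principal ideals). [cite: Hartshorne2010, §3] -/
theorem branch_lift_unique (x₁ P h₁ h' k k' : R) (hx : IsLeftRegular x₁)
    (hP : ∀ r : R, x₁ ∣ r * P → x₁ ∣ r)
    (hk : (inl x₁ + k • (ε : R[ε])) ∣ (inl (x₁ * P) + (h₁ * P + x₁ * h') • (ε : R[ε])))
    (hk' : (inl x₁ + k' • (ε : R[ε])) ∣ (inl (x₁ * P) + (h₁ * P + x₁ * h') • (ε : R[ε]))) :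
    Ideal.span {inl x₁ + k • (ε : R[ε])} = Ideal.span {inl x₁ + k' • (ε : R[ε])} := by
  rw [span_singleton_eq_iff _ _ _ hx]
  obtain ⟨c, hc⟩ := (branch_dvd_iff_of_regular_mod _ _ _ _ _ hx hP).mp hk
  obtain ⟨c', hc'⟩ := (branch_dvd_iff_of_regular_mod _ _ _ _ _ hx hP).mp hk'
  exact ⟨c - c', by linear_combination hc - hc'⟩

end BranchLift

end Summit.Ventures.HSemireg
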